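import Summits.BirchSwinnertonDyer.BirchSwinnertonDyer.Theorems.QuadraticBranchSignedControlPlusEtaLowerInclusionKuriharaCutManinFree
import Summits.BirchSwinnertonDyer.BirchSwinnertonDyer.Theorems.QuadraticBranchSignedControlPlusEtaLowerInclusionKuriharaRoad
import Summits.BirchSwinnertonDyer.Rank1Residual.X4.KimTamagawaDefect
import Literature.NumberTheory.EllipticCurves.CastellaSano2026.EtaKatoMainConjectureOfKimTamagawaDefectOPEN
import Literature.NumberTheory.EllipticCurves.ZywinaCMImageProofs
import HarnessLib

/-!
# Route `QuadraticBranchSignedControl` (rung K8, cell `bsd-potss`), crux `PlusEtaLowerInclusion`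
# (item stmt-BirchSwinnertonDyer-19601): THE CASTELLA–SANO ROAD — the Tamagawa rows
# (`stub_etaLower_tamagawaRows` of skeleton v5) and the whole crux BY NAME from Kim's Conjecture 1.10
# (refined Kurihara: `∂^{(∞)}(δ̃(W)) = ord_p Tam_W`) modulo ONE published theorem at `η` (Kim 1.11),
# ONE 2026 preprint theorem at `η` (Castella–Sano Thm. 1) and four published Manin-constant facts
# (a `--supports` file; seat `bsd-potss-k8eta-c1`, gen 13)

HONEST FRAMING (cell `bsd-potss`, run/shared/lean/pub/bsd-potss/; FULL-BSD rank ≤ 1 programme,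
tranche 1b, HUMAN RULING D-0036/D-0074; verbatim in every file): the target of record is FULL BSD for
every analytic-rank ≤ 1 curve over `ℚ`; this cell attacks rows B4/B5/B8 (additive potentially
supersingular primes). Crux 19601 `PlusEtaLowerInclusion` — Kobayashi's Eisenstein (lower) inclusion
of the even main conjecture at `η = ω^{(p−1)/2}`, `Char(X⁺(V/K_∞)^η) ⊆ (L_p⁺(V, η, X))`, for every
good supersingular `a_p(V) = 0` twist `V/ℚ`, `p ≥ 5`, whose `p`-adic tower is onto = Kato's lower IMC
inclusion for the ADDITIVE partner `W = V ⊗ χ_{p*}` — is OPEN class-wide and PROVED in print for no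
non-CM `V`. THIS FILE closes nothing, books nothing and claims `BSD(W, p)` for no pair; every theorem
is CONDITIONAL on displayed hypotheses, one of which (`hCS`) is an UNREFEREED PREPRINT claim.

WHAT. The registered skeleton v5 of the crux (`Cruxes/PlusEtaLowerInclusion/Lines/birth.lean`,
planner g26) cuts it — modulo Kim 2026 Thm. 1.11 (1) ⟹ (3) at `η` — into
`stub_etaLower_kurihara_tamFree` (Kurihara's conjecture mod `p` + Manin's input on the Tamagawa-`p`-free
partners; the Manin half is a theorem since gen 9, `PlusEtaManinInput.maninInput_of_quadraticBranch`)
and `stub_etaLower_tamagawaRows` ((E⁺_η) on the partners with `p ∣ ∏ c_ℓ(W)`; v5 docstring: "Kato's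
lower inclusion for `f_W` where Kim's criterion is void (Remark 6.2: 0/234 units); per row =
Λ-primitivity of `κ^{Kato,∞}(W)` (Kim Thm. 1.4), no finite certificate known"; gen 9: «needs one lemma
not in print»). Castella–Sano, *On refined nonvanishing conjectures by Kurihara and Kolyvagin*,
arXiv:2601.14504 (January 2026, UNREFEREED), Theorem 1: for `E/ℚ` non-CM, `p > 3`, `ρ̄` onto, Manin
constant prime to `p`, ANY reduction type at `p` — «`𝓜_∞(δ) = ord_p(Tam_E)` ⟺ Kato's IMC over `ℚ_∞`»
("the case `ord_p(Tam_E) > 0` … was wide open", §1.3.1) — is that lemma, in preprint. Read at `η` for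
`E := W` on Kobayashi's `η`-package (Literature OPEN binder
`CastellaSano2026.thm1_etaEisensteinInclusion_of_kimTamagawaDefect_OPEN`, this seat, frame VERBATIM that
of `Kim2026.thm111_etaEisensteinInclusion_of_kuriharaNumber_ne_zero`) it gives:

* §1 `etaPair_of_cs26_of_kimTamagawaDefect` — PER PAIR: (E⁺_η) at `(V, p)`, and (C1⁺_η) under the onto
  tower, from `hCS` + ONE globally minimal partner `W` (`5 ≤ p`, `ρ̄_{W,p}` onto; the preprint's non-CM
  binder is then automatic, Zywina 2015 Prop. 1.14), ONE parametrisation datum `D` with `p ∤ c_D` and the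
  `p`-unit period transfer, and Kim's identity `X4.KimTamagawaDefectAt W p D.f` — `p ∣ Tam_W` ALLOWED,
  no rank / height / `L`-value / local-torsion hypothesis.
* §2 `etaPair_of_cs26_of_maninFacts_of_kimConj110At` — the same with the Manin datum DISCHARGED by the
  four published Manin-constant facts: (E⁺_η) ∧ (C1⁺_η) at a tower-onto pair ⟸ Kim's Conjecture 1.10
  for its partner.
* §3 `tamagawaRows_of_cs26_of_maninFacts_of_kimConj110` — STUB CURRENCY: the statement registered as
  `stub_etaLower_tamagawaRows` (binders VERBATIM) ⟸ `hCS` + Manin facts + Kim's Conjecture 1.10 on the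
  Tamagawa-row partners (not a by-name closer — that needs a spelled-out re-registration).
* §4 `plusEtaLowerInclusion_of_kim111_of_cs26_of_maninFacts_of_kimConjecture110` — THE CRUX BY NAME
  from {Kim 1.11_η (PUBLISHED), Castella–Sano Thm. 1_η (PREPRINT), four Manin facts (PUBLISHED)} and ONE
  typed tree conjecture, `X4.kim2026_conjecture_1_10` (Kim's Conjecture 1.10 = Castella–Sano's
  Conjecture 2): on a Tamagawa-free partner the identity says `∂^{(∞)} = 0`, a unit Kurihara number, and
  Kim 1.11_η fires through gen 8's Kurihara cut; on a Tamagawa partner §2 fires. BOTH LOCI UNIFORMLY.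
* §5 the same with the v5 stub contents kept apart (`X4.KuriharaUnitAt` on the Tamagawa-free partners,
  Kim's identity on the Tamagawa partners).

CERTIFICATE SHAPE (numbers, not adjectives). Per Tamagawa row the displayed input of §1/§2 is the
EQUALITY `∂^{(∞)}(δ̃(W)) = t`, `t := ord_p Tam_W ≥ 1`. Its `≤` half is finitely certifiable (ONE cyclic
Kolyvagin level with ONE Kurihara number `δ̃_n ≢ 0 (mod p^k)`, `k ≤ t + 1`;
`X4.exists_certificate_of_kuriharaPartialInfty_le`); its `≥` half («every cyclic-level Kurihara number is
divisible by `p^t`») is the Kato-integrality side and is NOT a finite certificate (consistent with gens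
7–8's censuses: 234 Tamagawa-row partners at `p ∈ {5, 7}`, 0 unit Kurihara numbers, as Kim's Remark 6.2
predicts). So this road does NOT replace the level-zero per-row certificates of the 20 Tamagawa census
rows; it replaces the CLASS-WIDE label «no finite certificate known / nothing in print» of the stub by
«Kim's Conjecture 1.10 for `f_W`, modulo a 2026 preprint read at `η`».

HONEST LABEL: CONDITIONAL throughout (`hCS` is a preprint claim, `hKim` and the Manin facts are
published theorems not formalised, Kim's Conjecture 1.10 is OPEN); closes nothing; the registered
skeleton v5 (sha `d5f6e6e5ddc2`) is untouched; nothing is booked; BSD is not proved by any of this.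

References: [CastellaSano2026] Thm. 1, Conj. 2, §1.3.1, Prop. 2.2.3, §2.4 (PDF pp. 3–4, 6, 9–11);
[Kim2022StructureSelmer] Conj. 1.10, Thm. 1.11 (PDF p. 8), Remark 6.2 (PDF p. 31); [Kobayashi2003] §4
(p. 8), §5 (p. 10), proof of Thm. 7.4 (p. 13); [Kato2004Asterisque] Conj. 12.10; [Zywina2015] Prop.
1.14; [Mazur1978] Cor. 4.1; [AbbesUllmo1996] Thm. A; [Cesnavicius2018] Thm. 1.2; [Stevens1989] (5.2), (5.4).
-/

set_option autoImplicit false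
-- sibling precedent (`…PlusEtaLowerInclusionKuriharaCut.lean`): the directory name repeats the summit name
set_option linter.dupNamespace false

noncomputable section

open scoped Classical

namespace Summit.BirchSwinnertonDyer.BirchSwinnertonDyer.Theorems.PlusEtaCastellaSanoRoad

open CongruenceSubgroup WeierstrassCurve Field Literature.NumberTheory.EllipticCurves
  Literature.NumberTheory.EllipticCurves.ModularForms
  Literature.NumberTheory.GaloisRepresentations
  Literature.NumberTheory.EllipticCurves.Rank1Residual
  Literature.NumberTheory.EllipticCurves.Rank1Residual.Typed
  Summit.BirchSwinnertonDyer.Rank1Residual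
  Summit.BirchSwinnertonDyer.BirchSwinnertonDyer.Theorems
  Summit.BirchSwinnertonDyer.BirchSwinnertonDyer.Theses.QuadraticBranchSignedControl
  ZpExtension

open Summit.BirchSwinnertonDyer.Rank1Residual.Additive hiding EtaSignedSelmerDualData
  IsQuadraticBranchPlusLFunction IsQuadraticBranchMinusLFunction

/-! ## §0 Bookkeeping: the non-CM binder; Kurihara numbers modulo `p ^ 1` versus modulo `p` -/

/-- **The non-CM hypothesis of Castella–Sano is automatic on every K8 partner**: a curve with surjective
`ρ̄_{W,p}` at an odd prime `p` has no complex multiplication (Zywina 2015 Prop. 1.14/1.16, Serre 1972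
§4.5 — the tree theorem `WeierstrassCurve.not_hasSurjectiveModNGaloisRep_of_hasCM`).
[cite: Zywina2015, Prop. 1.14 and Prop. 1.16 (§1.9)] [cite: Serre1972, §4.5] -/
theorem not_hasCM_of_hasSurjectiveModNGaloisRep (W : WeierstrassCurve ℚ) [W.IsElliptic] {p : ℕ}
    [hp : Fact p.Prime] (hp2 : p ≠ 2) (hsurj : W.HasSurjectiveModNGaloisRep p) : ¬ W.HasCM :=
  fun hCM ↦ W.not_hasSurjectiveModNGaloisRep_of_hasCM hCM hp.out hp2 hsurj

/-- **Transport of a non-vanishing Kurihara number along an equality of moduli** (`m = m'`; used with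
`p ^ 1 = p`: the invariants file and `X4.KuriharaUnitAt` speak of `kuriharaNumber f (p ^ 1) n ψ`, Kim's
Thm. 1.11 at `η` of `kuriharaNumber f p n ψ`, and `ZMod (p ^ 1)` is not definitionally `ZMod p`).
[cite: Kim2022StructureSelmer, §1.4.3 (PDF p. 7)] -/
theorem exists_kuriharaNumber_ne_zero_of_modulus_eq {m m' : ℕ} (h : m = m') {N : ℕ}
    (f : CuspForm (Gamma0 N) 2) (n : ℕ) [NeZero n]
    (ψ : (ℓ : ℕ) → (ZMod ℓ)ˣ →* Multiplicative (ZMod m))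
    (hψ : ∀ ℓ ∈ n.primeFactors, Function.Surjective (ψ ℓ)) (hne : kuriharaNumber f m n ψ ≠ 0) :
    ∃ ψ' : (ℓ : ℕ) → (ZMod ℓ)ˣ →* Multiplicative (ZMod m'),
      (∀ ℓ ∈ n.primeFactors, Function.Surjective (ψ' ℓ)) ∧ kuriharaNumber f m' n ψ' ≠ 0 := by
  subst h
  exact ⟨ψ, hψ, hne⟩

/-- **`X4.KuriharaUnitAt W p f` in the binder shape of Kim's Thm. 1.11 at `η`**: a level `n ∈ 𝒩₁(W, p)`
with the cyclicity flag, surjective `ψ_ℓ : (ℤ/ℓ)ˣ ↠ ℤ/p` and `kuriharaNumber f p n ψ ≠ 0` (moduli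
transported along `p ^ 1 = p`). [cite: Kim2022StructureSelmer, Thm. 1.11 (1) (PDF p. 8), §1.4.3 (PDF p. 7)] -/
theorem exists_kuriharaUnit_of_kuriharaUnitAt (W : WeierstrassCurve ℚ) [W.IsGloballyMinimal] (p : ℕ)
    {N : ℕ} [NeZero N] (f : CuspForm (Gamma0 N) 2) (h : X4.KuriharaUnitAt W p f) :
    ∃ (n : ℕ) (_ : NeZero n), Kato.IsKolyvaginProduct W p 1 n ∧
      (∀ (ℓ : ℕ) [Fact ℓ.Prime], ℓ ∣ n →
        Nat.card {P : ((WeierstrassCurve.integralModelInt W).map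
          (Int.castRingHom (ZMod ℓ))).toAffine.Point // p • P = 0} ≤ p) ∧
      ∃ ψ : (ℓ : ℕ) → (ZMod ℓ)ˣ →* Multiplicative (ZMod p),
        (∀ ℓ ∈ n.primeFactors, Function.Surjective (ψ ℓ)) ∧ kuriharaNumber f p n ψ ≠ 0 := by
  obtain ⟨n, hn0, hn, hcyc, ψ, hψ, hne⟩ := h
  obtain ⟨ψ', hψ', hne'⟩ := exists_kuriharaNumber_ne_zero_of_modulus_eq (pow_one p) f n ψ hψ hne
  exact ⟨n, hn0, hn, hcyc, ψ', hψ', hne'⟩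

/-- **The surjectivity of `ρ̄_{W,p}` from the onto tower of `V`** along `C • W^{(p*)} = V` (the tower at
`m = 1`, transported by the twist involution on models). Bookkeeping shared by §2–§5.
[cite: SilvermanAEC2009, X.5 Cor. 5.4] -/
theorem hasSurjectiveModNGaloisRep_partner_of_tower {V : WeierstrassCurve ℚ} [V.IsElliptic]
    {W : WeierstrassCurve ℚ} [W.IsElliptic] (C : VariableChange ℚ) (p : ℕ) [Fact p.Prime]
    (hCV : C • W.quadraticTwist ((-1) ^ (p / 2) * p) = V)
    (htower : ∀ m : ℕ, V.HasSurjectiveModNGaloisRep (p ^ m : ℕ)) : W.HasSurjectiveModNGaloisRep p := by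
  have hd : ((-1 : ℚ) ^ (p / 2) * p) ≠ 0 :=
    mul_ne_zero (pow_ne_zero _ (by norm_num)) (by exact_mod_cast (Fact.out : p.Prime).ne_zero)
  obtain ⟨C', hC'⟩ := exists_variableChange_twist_of_model_twist W hd hCV
  simpa only [pow_one] using
    (GaloisImage.hasSurjectiveModNGaloisRep_pow_iff_of_model_twist V p hd ⟨C', hC'⟩ 1).mpr (htower 1)

/-! ## §1 THE CASTELLA–SANO ROAD per pair: (E⁺_η), and (C1⁺_η) under the tower, from Kim's Tamagawa-defect identity -/

section Road

variable {V : WeierstrassCurve ℚ} [V.IsElliptic] [V.IsGloballyMinimal] {p : ℕ} [Fact p.Prime]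

/-- **THE CASTELLA–SANO ROAD to (E⁺_η) ∧ (C1⁺_η) at a pair, `p ∣ Tam_W` ALLOWED** (Castella–Sano 2026
Thm. 1 (i) ⟹ (ii) at `η` + Kobayashi's `η`-package + the proof of Thm. 7.4). Displayed hypothesis `hCS` =
the Literature OPEN binder `CastellaSano2026.thm1_etaEisensteinInclusion_of_kimTamagawaDefect_OPEN` (an
UNREFEREED PREPRINT claim read at `η` through the flagged zeta-line identification; see that file). Per-pair
inputs in hypothesis position: ONE globally minimal partner `W` of `V` (`C • W^{(p*)} = V`) with `5 ≤ p`
and `ρ̄_{W,p}` onto (`hsurj`; the preprint's non-CM binder is then automatic, §0), ONE modular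
parametrisation datum `D` with `p ∤ c_D` (`hc`) and the `p`-unit period transfer (`hper`), and KIM'S
TAMAGAWA-DEFECT IDENTITY `X4.KimTamagawaDefectAt W p D.f` (`∂^{(∞)}(δ̃) = ord_p ∏_v c_v(W)`, `hKD`).
CONCLUSION: (E⁺_η) `QuadraticBranchPlusEtaLowerInclusionAt V p`
(`KuriharaRoad.plusEtaLowerInclusionAt_of_etaEisensteinFrame`), and (C1⁺_η)
`QuadraticBranchPlusEtaMainConjectureAt V p` granted the onto tower of `V`
(`KuriharaRoad.plusEtaMainConjectureAt_of_etaEisensteinFrame_of_surjective`). No rank hypothesis, no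
height, no `L`-value, no local-torsion binder, no `p ∤ Tam_W`. CONDITIONAL on `hCS` and the displayed
inputs; closes nothing. [cite: CastellaSano2026, Thm. 1 (PDF p. 4), §2.4 (PDF pp. 10–11)]
[cite: Kim2022StructureSelmer, Conj. 1.10 (PDF p. 8)] [cite: Kobayashi2003, proof of Thm. 7.4 (p. 13), §4 (p. 8), §5 (p. 10)] -/
theorem etaPair_of_cs26_of_kimTamagawaDefect
    (hCS : CastellaSano2026.thm1_etaEisensteinInclusion_of_kimTamagawaDefect_OPEN)
    (W : WeierstrassCurve ℚ) [W.IsElliptic] [W.IsGloballyMinimal] (C : VariableChange ℚ)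
    (hCV : C • W.quadraticTwist ((-1) ^ (p / 2) * p) = V) (h5 : 5 ≤ p)
    (hsurj : W.HasSurjectiveModNGaloisRep p)
    {NW : ℕ} [NeZero NW] (D : ModularParametrizationData W NW) (hc : ¬ (p : ℤ) ∣ D.maninConstant)
    (hper : ∃ u : ℚ, ‖(u : ℚ_[p])‖ = 1 ∧ W.realPeriodRat = u * plusPeriod D.f)
    (hKD : X4.KimTamagawaDefectAt W p D.f) :
    QuadraticBranchPlusEtaLowerInclusionAt V p ∧
      ((∀ m : ℕ, V.HasSurjectiveModNGaloisRep (p ^ m : ℕ)) →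
        QuadraticBranchPlusEtaMainConjectureAt V p) := by
  haveI : ContinuousSMul ℤ_[p] (W.tateModule p) := TateModule.continuousSMul_padicInt
  have hE : ∀ (K₀ : Type) [Field K₀] [NumberField K₀] [IsCyclotomicExtension {p} ℚ K₀]
        [(galRange (K := ℚ) K₀).Normal] (ηq : absoluteGaloisGroup ℚ →* ℤˣ),
        (∀ σ ∈ galRange (K := ℚ) K₀, ηq σ = 1) → ηq ≠ 1 →
      ∀ {N : ℕ} [NeZero N] {f : CuspForm (Gamma0 N) 2},
        p ≠ 2 → V.HasGoodReductionAtPrime p → V.frobeniusTrace p = 0 → IsNewformOf V f →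
      ∀ (ϖ : ℚ), (if Even (p / 2) then (ϖ : ℝ) * V.realPeriodRat = plusPeriod f
          else (ϖ : ℝ) * V.imaginaryPeriodRat = minusPeriod f) →
      ∀ (κ : ZpExtension ℚ p) (γ : absoluteGaloisGroup ℚ),
        κ.IsCyclotomic → κ.IsTopGenerator γ → γ ∈ galRange (K := ℚ) K₀ → IsCyclotomicVariable p γ →
      ∀ (I : Kato2004.IwasawaH1Data W p κ γ) (FB : W.FineSelmerDualData κ γ),
        ∃ d : Kobayashi2003.EtaKatoColemanPoitouTateData p K₀ ηq V f ϖ κ γ W I FB,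
          Module.charIdeal (IwasawaAlgebra p) FB.X ≤
            Module.charIdeal (IwasawaAlgebra p)
              (I.H ⧸ Submodule.span (IwasawaAlgebra p) {d.z}) :=
    fun K₀ _ _ _ _ ηq hηK hη1 N _ f hp2 hgood hap hf ϖ hϖ κ γ hκ hγ hγK hγc I FB =>
      hCS p K₀ ηq hηK hη1 V hp2 hgood hap hf ϖ hϖ κ γ hκ hγ hγK hγc W C hCV h5
        (not_hasCM_of_hasSurjectiveModNGaloisRep W hp2 hsurj) hsurj D hc hper hKD I FB
  exact ⟨KuriharaRoad.plusEtaLowerInclusionAt_of_etaEisensteinFrame W hE,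
    fun hs => KuriharaRoad.plusEtaMainConjectureAt_of_etaEisensteinFrame_of_surjective W hE hs⟩

/-! ## §2 The road with the Manin datum DISCHARGED: (E⁺_η) ∧ (C1⁺_η) at a tower-onto pair from Kim's Conjecture 1.10 for its partner -/

/-- **(E⁺_η) ∧ (C1⁺_η) at a tower-onto pair from Castella–Sano Thm. 1_η + the four Manin-constant facts +
Kim's Conjecture 1.10 for the partner.** For a globally minimal good supersingular `a_p = 0` curve `V`,
`p ≥ 5`, with onto `p`-adic tower and a globally minimal partner `W` (`C • W^{(p*)} = V`): IF every
admissible parametrisation datum `D` of `W` (`p ∤ c_D`, `p`-unit period transfer) satisfies Kim's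
identity `∂^{(∞)}(δ̃(D.f)) = ord_p Tam_W` — Kim's Conjecture 1.10 / Castella–Sano's Conjecture 2 at
`(W, p)`, `p ∣ Tam_W` or not — then the Eisenstein inclusion AND the even main conjecture at `η` hold at
`(V, p)`. The Manin datum exists by `PlusEtaManinInput.maninInput_of_quadraticBranch` (modulo Mazur 1978
Cor. 4.1 `hM`, Abbes–Ullmo 1996 `hAU`, Česnavičius 2018 `hC2`, modularity `hnf`); `ρ̄_{W,p}` onto from the
tower. CONDITIONAL; per pair; closes nothing; nothing booked.
[cite: CastellaSano2026, Thm. 1 and Conj. 2 (PDF p. 4)] [cite: Kim2022StructureSelmer, Conj. 1.10 (PDF p. 8)]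
[cite: Mazur1978, Cor. 4.1] [cite: Cesnavicius2018, Thm. 1.2] [cite: Stevens1989, Lemmas (5.2), (5.4)] -/
theorem etaPair_of_cs26_of_maninFacts_of_kimConj110At
    (hCS : CastellaSano2026.thm1_etaEisensteinInclusion_of_kimTamagawaDefect_OPEN)
    (hM : mazur_not_dvd_maninConstant_of_odd)
    (hAU : abbesUllmo_not_dvd_maninConstant_of_not_dvd_level)
    (hC2 : cesnavicius_not_two_dvd_maninConstant_of_two_dvd_level)
    (hnf : exists_isNewformOf)
    (h5 : 5 ≤ p) (hgood : V.HasGoodReductionAtPrime p)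
    (htower : ∀ m : ℕ, V.HasSurjectiveModNGaloisRep (p ^ m : ℕ))
    (W : WeierstrassCurve ℚ) [W.IsElliptic] [W.IsGloballyMinimal] (C : VariableChange ℚ)
    (hCV : C • W.quadraticTwist ((-1) ^ (p / 2) * p) = V)
    (hK : ∀ {NW : ℕ} [NeZero NW] (D : ModularParametrizationData W NW),
      ¬ (p : ℤ) ∣ D.maninConstant →
      (∃ u : ℚ, ‖(u : ℚ_[p])‖ = 1 ∧ W.realPeriodRat = u * plusPeriod D.f) →
      X4.KimTamagawaDefectAt W p D.f) :
    QuadraticBranchPlusEtaLowerInclusionAt V p ∧ QuadraticBranchPlusEtaMainConjectureAt V p := by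
  have hsurj : W.HasSurjectiveModNGaloisRep p := hasSurjectiveModNGaloisRep_partner_of_tower C p hCV htower
  obtain ⟨NW, _, D, hc, hper⟩ :=
    PlusEtaManinInput.maninInput_of_quadraticBranch hM hAU hC2 hnf C p (by omega) hCV hgood hsurj
  have h := etaPair_of_cs26_of_kimTamagawaDefect hCS W C hCV h5 hsurj D hc hper (hK D hc hper)
  exact ⟨h.1, h.2 htower⟩

end Road

/-! ## §3 STUB CURRENCY: `stub_etaLower_tamagawaRows` (skeleton v5, binders verbatim) from Castella–Sano Thm. 1_η + Manin facts + Kim's Conjecture 1.10 on the Tamagawa partners -/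

/-- **The hardest registered stub reduced to Kim's Conjecture 1.10 on its own rows.** Modulo the OPEN
preprint binder `hCS` and the four Manin-constant facts, the statement registered as
`stub_etaLower_tamagawaRows` of skeleton v5 (`Cruxes/PlusEtaLowerInclusion/Lines/birth.lean`; reproduced
VERBATIM as the conclusion: (E⁺_η) on every tower-onto good supersingular `a_p = 0` pair, `p ≥ 5`, whose
globally minimal partner `W` has `p ∣ ∏ c_ℓ(W)`) follows from Kim's Tamagawa-defect identity for every
admissible parametrisation datum of every such partner — Kim's Conjecture 1.10 = Castella–Sano's
Conjecture 2 restricted to the Tamagawa rows of the crux. (Not a by-name closer of the stub — that needs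
a spelled-out re-registration with the binders `hCS`, `hM`, `hAU`, `hC2`, `hnf`, `hK`; this is the
reduction the planner can register.) CONDITIONAL; closes nothing; nothing booked.
[cite: CastellaSano2026, Thm. 1 and Conj. 2 (PDF p. 4), §1.3.1 (PDF p. 6)]
[cite: Kim2022StructureSelmer, Conj. 1.10 (PDF p. 8), Remark 6.2 (PDF p. 31)] [cite: Mazur1978, Cor. 4.1]
[cite: Cesnavicius2018, Thm. 1.2] -/
theorem tamagawaRows_of_cs26_of_maninFacts_of_kimConj110
    (hCS : CastellaSano2026.thm1_etaEisensteinInclusion_of_kimTamagawaDefect_OPEN)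
    (hM : mazur_not_dvd_maninConstant_of_odd)
    (hAU : abbesUllmo_not_dvd_maninConstant_of_not_dvd_level)
    (hC2 : cesnavicius_not_two_dvd_maninConstant_of_two_dvd_level)
    (hnf : exists_isNewformOf)
    (hK : ∀ (V : WeierstrassCurve ℚ) [V.IsElliptic] [V.IsGloballyMinimal] (W : WeierstrassCurve ℚ)
      [W.IsElliptic] [W.IsGloballyMinimal] (C : VariableChange ℚ) (p : ℕ) [Fact p.Prime],
      5 ≤ p → C • W.quadraticTwist ((-1) ^ (p / 2) * p) = V → V.HasGoodReductionAtPrime p →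
      V.frobeniusTrace p = 0 → (∀ m : ℕ, V.HasSurjectiveModNGaloisRep (p ^ m : ℕ)) →
      p ∣ W.tamagawaProduct →
      ∀ {NW : ℕ} [NeZero NW] (D : ModularParametrizationData W NW),
        ¬ (p : ℤ) ∣ D.maninConstant →
        (∃ u : ℚ, ‖(u : ℚ_[p])‖ = 1 ∧ W.realPeriodRat = u * plusPeriod D.f) →
        X4.KimTamagawaDefectAt W p D.f) :
    ∀ (V : WeierstrassCurve ℚ) [V.IsElliptic] [V.IsGloballyMinimal] (W : WeierstrassCurve ℚ)
      [W.IsElliptic] [W.IsGloballyMinimal] (C : VariableChange ℚ) (p : ℕ) [Fact p.Prime],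
      5 ≤ p → C • W.quadraticTwist ((-1) ^ (p / 2) * p) = V → V.HasGoodReductionAtPrime p →
      V.frobeniusTrace p = 0 → (∀ m : ℕ, V.HasSurjectiveModNGaloisRep (p ^ m : ℕ)) →
      p ∣ W.tamagawaProduct → QuadraticBranchPlusEtaLowerInclusionAt V p := by
  intro V _ _ W _ _ C p _ h5 hCV hgood hap htower htam
  exact (etaPair_of_cs26_of_maninFacts_of_kimConj110At hCS hM hAU hC2 hnf h5 hgood htower W C hCV
    (fun D hc hper => hK V W C p h5 hCV hgood hap htower htam D hc hper)).1

/-! ## §4 THE CRUX BY NAME from Kim 1.11_η (PUB) + Castella–Sano Thm. 1_η (PRE) + four Manin facts (PUB) + ONE typed tree conjecture: Kim's Conjecture 1.10 -/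

/-- **THE CASTELLA–SANO CUT OF CRUX 19601.** `PlusEtaLowerInclusion` — (E⁺_η) for every tower-onto good
supersingular `a_p = 0` twist `V`, `p ≥ 5` — follows from
(K1) `hKim` : Kim 2026 Thm. 1.11 (1) ⟹ (3) at `η` (PUBLISHED, Amer. J. Math. 148; named fact,
  hypothesis position);
(CS) `hCS` : Castella–Sano 2026 Thm. 1 (i) ⟹ (ii) at `η` (UNREFEREED PREPRINT arXiv:2601.14504; OPEN
  binder, hypothesis position);
(M) `hM`, `hAU`, `hC2`, `hnf` : Mazur 1978 Cor. 4.1, Abbes–Ullmo 1996 Thm. A, Česnavičius 2018 Thm. 1.2,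
  modularity (PUBLISHED; they give every tower-onto partner an admissible parametrisation datum,
  `PlusEtaManinInput.maninInput_of_quadraticBranch`);
(K110) `hK110` : `X4.kim2026_conjecture_1_10` — Kim's Conjecture 1.10 (= Castella–Sano's Conjecture 2,
  "refined Kurihara"), the printed sentence, a typed `@[conjecture]` of the tree: for `W/ℚ`, `p ≥ 5`,
  `ρ̄_{W,p}` onto and an admissible datum `D`, `∂^{(∞)}(δ̃(D.f)) = ∑_ℓ ord_p c_ℓ(W)`.
Proof: the globally minimal partner `W` of `V` and `ρ̄_{W,p}` onto from the tower
(`PlusEtaKuriharaCut.exists_minimalPartner_of_tower`); split on `p ∣ ∏ c_ℓ(W)`. Tamagawa-free: the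
identity reads `∂^{(∞)} = 0`, i.e. a unit Kurihara number at a cyclic `𝒩₁`-level
(`X4.kimTamagawaDefectLeAt_iff_kuriharaUnitAt_of_not_dvd`, moduli transported along `p ^ 1 = p`), the
merged Σ₁ datum of gen 8's Kurihara cut (`PlusEtaKuriharaCut.plusEtaLowerInclusion_of_kim111_of_kuriharaData_of_tamagawaRows`),
and Kim 1.11_η fires. Tamagawa rows: §2. So MODULO two theorems at `η` (one published, one preprint)
and four published Manin facts, THE OPEN CONTENT OF CRUX 19601 IS ONE PRINT-NAMED CONJECTURE ON THE
ADDITIVE PARTNERS — Kim's Conjecture 1.10 — on BOTH loci of the v5 cut uniformly (only its instances on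
the tower-onto Gss2 partners are used, and on the Tamagawa-free ones only its `≤` half). CONDITIONAL
(five displayed hypotheses + one typed conjecture); closes nothing by itself; nothing booked; BSD is not
proved by any of this. [cite: Kim2022StructureSelmer, Thm. 1.11 and Conj. 1.10 (PDF p. 8), Remark 6.2 (PDF p. 31)]
[cite: CastellaSano2026, Thm. 1, Cor. 1 and Conj. 2 (PDF p. 4), §1.3.1 (PDF p. 6)]
[cite: Kobayashi2003, §4 Even main conjecture (p. 8), proof of Thm. 7.4 (p. 13)]
[cite: Mazur1978, Cor. 4.1] [cite: Cesnavicius2018, Thm. 1.2] [cite: Stevens1989, Lemmas (5.2), (5.4)] -/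
theorem plusEtaLowerInclusion_of_kim111_of_cs26_of_maninFacts_of_kimConjecture110
    (hKim : Kim2026.thm111_etaEisensteinInclusion_of_kuriharaNumber_ne_zero)
    (hCS : CastellaSano2026.thm1_etaEisensteinInclusion_of_kimTamagawaDefect_OPEN)
    (hM : mazur_not_dvd_maninConstant_of_odd)
    (hAU : abbesUllmo_not_dvd_maninConstant_of_not_dvd_level)
    (hC2 : cesnavicius_not_two_dvd_maninConstant_of_two_dvd_level)
    (hnf : exists_isNewformOf)
    (hK110 : X4.kim2026_conjecture_1_10) : PlusEtaLowerInclusion := by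
  refine PlusEtaKuriharaCut.plusEtaLowerInclusion_of_kim111_of_kuriharaData_of_tamagawaRows hKim ?_ ?_
  · -- Tamagawa-free partners: Kim's identity is `∂^{(∞)} = 0`, a unit Kurihara number
    intro V _ _ W _ _ C p _ h5 hCV hgood _hap htower htam
    have hsurj : W.HasSurjectiveModNGaloisRep p :=
      hasSurjectiveModNGaloisRep_partner_of_tower C p hCV htower
    obtain ⟨NW, _, D, hc, hper⟩ :=
      PlusEtaManinInput.maninInput_of_quadraticBranch hM hAU hC2 hnf C p (by omega) hCV hgood hsurj
    have hKD : X4.KimTamagawaDefectAt W p D.f := hK110 W p h5 hsurj D hc hper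
    have hunit : X4.KuriharaUnitAt W p D.f :=
      (X4.kimTamagawaDefectLeAt_iff_kuriharaUnitAt_of_not_dvd W p D.f htam).mp
        ((X4.kimTamagawaDefectAt_iff W p D.f).mp hKD).1
    obtain ⟨n, _, hn, hcyc, ψ, hψ, hδ⟩ := exists_kuriharaUnit_of_kuriharaUnitAt W p D.f hunit
    exact ⟨NW, inferInstance, D, hc, hper, n, inferInstance, hn, hcyc, ψ, hψ, hδ⟩
  · -- Tamagawa rows: §2
    intro V _ _ W _ _ C p _ h5 hCV hgood _hap htower _htam
    exact (etaPair_of_cs26_of_maninFacts_of_kimConj110At hCS hM hAU hC2 hnf h5 hgood htower W C hCV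
      (fun D hc hper => hK110 W p h5 (hasSurjectiveModNGaloisRep_partner_of_tower C p hCV htower)
        D hc hper)).1

/-! ## §5 The same cut with the v5 stub contents kept apart: Kurihara's conjecture mod `p` on the Tamagawa-free partners + Kim's identity on the Tamagawa partners -/

/-- **The Castella–Sano cut, split along the v5 stubs.** `PlusEtaLowerInclusion` from (K1) `hKim`, (CS)
`hCS`, (M) the four Manin facts, and
(K2b′) `hKur` : for every ADMISSIBLE parametrisation datum `D` of a Tamagawa-`p`-free tower-onto partner, a
  unit Kurihara number of `D.f` at a cyclic `𝒩₁`-level (`X4.KuriharaUnitAt W p D.f` — Kurihara's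
  conjecture mod `p`, Kim Conj. 1.9 = Castella–Sano Conj. 1; the open content of
  `stub_etaLower_kurihara_tamFree`, cf. `PlusEtaManinInput.kuriharaData_of_maninFacts_of_kuriharaUnit`,
  here asked only for admissible `D`);
(K3′) `hDef` : Kim's identity `X4.KimTamagawaDefectAt W p D.f` for every admissible datum of a tower-onto
  partner with `p ∣ ∏ c_ℓ(W)` (the open content of `stub_etaLower_tamagawaRows` modulo `hCS`, §3).
CONDITIONAL; closes nothing by itself; nothing booked.
[cite: Kim2022StructureSelmer, Conj. 1.9, Conj. 1.10 and Thm. 1.11 (PDF p. 8)]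
[cite: CastellaSano2026, Thm. 1, Cor. 1, Conj. 1 and Conj. 2 (PDF pp. 3–4)]
[cite: Kobayashi2003, §4 Even main conjecture (p. 8)] [cite: Mazur1978, Cor. 4.1] [cite: Cesnavicius2018, Thm. 1.2] -/
theorem plusEtaLowerInclusion_of_kim111_of_cs26_of_maninFacts_of_kuriharaUnit_of_kimDefect
    (hKim : Kim2026.thm111_etaEisensteinInclusion_of_kuriharaNumber_ne_zero)
    (hCS : CastellaSano2026.thm1_etaEisensteinInclusion_of_kimTamagawaDefect_OPEN)
    (hM : mazur_not_dvd_maninConstant_of_odd)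
    (hAU : abbesUllmo_not_dvd_maninConstant_of_not_dvd_level)
    (hC2 : cesnavicius_not_two_dvd_maninConstant_of_two_dvd_level)
    (hnf : exists_isNewformOf)
    (hKur : ∀ (V : WeierstrassCurve ℚ) [V.IsElliptic] [V.IsGloballyMinimal] (W : WeierstrassCurve ℚ)
      [W.IsElliptic] [W.IsGloballyMinimal] (C : VariableChange ℚ) (p : ℕ) [Fact p.Prime],
      5 ≤ p → C • W.quadraticTwist ((-1) ^ (p / 2) * p) = V → V.HasGoodReductionAtPrime p →
      V.frobeniusTrace p = 0 → (∀ m : ℕ, V.HasSurjectiveModNGaloisRep (p ^ m : ℕ)) →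
      ¬ p ∣ W.tamagawaProduct →
      ∀ {NW : ℕ} [NeZero NW] (D : ModularParametrizationData W NW),
        ¬ (p : ℤ) ∣ D.maninConstant →
        (∃ u : ℚ, ‖(u : ℚ_[p])‖ = 1 ∧ W.realPeriodRat = u * plusPeriod D.f) →
        X4.KuriharaUnitAt W p D.f)
    (hDef : ∀ (V : WeierstrassCurve ℚ) [V.IsElliptic] [V.IsGloballyMinimal] (W : WeierstrassCurve ℚ)
      [W.IsElliptic] [W.IsGloballyMinimal] (C : VariableChange ℚ) (p : ℕ) [Fact p.Prime],
      5 ≤ p → C • W.quadraticTwist ((-1) ^ (p / 2) * p) = V → V.HasGoodReductionAtPrime p →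
      V.frobeniusTrace p = 0 → (∀ m : ℕ, V.HasSurjectiveModNGaloisRep (p ^ m : ℕ)) →
      p ∣ W.tamagawaProduct →
      ∀ {NW : ℕ} [NeZero NW] (D : ModularParametrizationData W NW),
        ¬ (p : ℤ) ∣ D.maninConstant →
        (∃ u : ℚ, ‖(u : ℚ_[p])‖ = 1 ∧ W.realPeriodRat = u * plusPeriod D.f) →
        X4.KimTamagawaDefectAt W p D.f) :
    PlusEtaLowerInclusion := by
  refine PlusEtaKuriharaCut.plusEtaLowerInclusion_of_kim111_of_kuriharaData_of_tamagawaRows hKim ?_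
    (tamagawaRows_of_cs26_of_maninFacts_of_kimConj110 hCS hM hAU hC2 hnf hDef)
  intro V _ _ W _ _ C p _ h5 hCV hgood hap htower htam
  have hsurj : W.HasSurjectiveModNGaloisRep p :=
    hasSurjectiveModNGaloisRep_partner_of_tower C p hCV htower
  obtain ⟨NW, _, D, hc, hper⟩ :=
    PlusEtaManinInput.maninInput_of_quadraticBranch hM hAU hC2 hnf C p (by omega) hCV hgood hsurj
  obtain ⟨n, _, hn, hcyc, ψ, hψ, hδ⟩ :=
    exists_kuriharaUnit_of_kuriharaUnitAt W p D.f (hKur V W C p h5 hCV hgood hap htower htam D hc hper)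
  exact ⟨NW, inferInstance, D, hc, hper, n, inferInstance, hn, hcyc, ψ, hψ, hδ⟩

end Summit.BirchSwinnertonDyer.BirchSwinnertonDyer.Theorems.PlusEtaCastellaSanoRoad

end
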